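import Literature.RepresentationTheory.TwistedCoinvariants
import HarnessLib

/-!
# Twisted coinvariants: transport along an isomorphism of the acting group

Topic `RepresentationTheory`; namespace `Literature.RepresentationTheory.TwistedCoinv` (sequel of `TwistedCoinvariants`).
One `def` with body (`coinvTransportEquiv`, a `LinearEquiv`) and theorems; no named facts, no `sorry`.

For a representation `ρW : Representation k H S`, a character `χ : H →* kˣ` and a group ISOMORPHISM `e : H′ ≃* H`, the
`χ′`-coinvariants of `ρW ∘ e` for `χ′ = χ ∘ e` are the `χ`-coinvariants of `ρW`: the two relation submodules
`span {ρW (e h′) v − χ′ h′ • v}` and `span {ρW h v − χ h • v}` of `S` coincide (`ker_comp_eq_ker`), so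
`coinvTransportEquiv : Coinv (ρW ∘ e) χ′ ≃ₗ[k] Coinv ρW χ` is the identity on classes (`Submodule.quotEquivOfEq`;
`coinvTransportEquiv_mk`, `_symm_mk`), and it intertwines the actions `rep χ′ ρV` / `rep χ ρV` induced by any representation `ρV`
commuting with `ρW` (`coinvTransportEquiv_rep`, `_symm_rep`).  (The situation of one torus acting through two isomorphic copies,
e.g. the centre `E¹(𝔸_f)` of a unitary group and the unitary group of a hermitian line, [GelbartRogawski1991, §3.1 Remark p. 457].)

## References
* [GelbartRogawski1991] S. Gelbart, J. Rogawski, *L-functions and Fourier–Jacobi coefficients for the unitary group U(3)*,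
  Invent. Math. 105 (1991), §3.1 Remark p. 457 L4–13.
* [MoeglinVignerasWaldspurger1987] C. Mœglin, M.-F. Vignéras, J.-L. Waldspurger, *Correspondances de Howe sur un corps
  p-adique*, LNM 1291 (1987), Chap. 2 II.2, Chap. 3 IV.
-/

set_option autoImplicit false

noncomputable section

namespace Literature.RepresentationTheory.TwistedCoinv

section CompEquiv

variable {k : Type*} [CommRing k] {G H H' S : Type*} [Group G] [Group H] [Group H'] [AddCommGroup S] [Module k S]
variable (ρW : Representation k H S) (χ : H →* kˣ) (e : H' ≃* H) (χ' : H' →* kˣ)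

/-- **Same relation submodule after reparametrising the acting group by an isomorphism**: for `e : H′ ≃* H` and
`χ′ = χ ∘ e`, `span {ρW (e h′) v − χ′ h′ • v} = span {ρW h v − χ h • v}`. [cite: GelbartRogawski1991, §3.1 Remark p. 457 L4–13] -/
theorem ker_comp_eq_ker (hχ : ∀ h' : H', χ' h' = χ (e h')) : ker (ρW.comp e.toMonoidHom) χ' = ker ρW χ := by
  refine le_antisymm ?_ ?_
  · rw [ker, Submodule.span_le]
    rintro _ ⟨⟨h', v⟩, rfl⟩
    show (ρW.comp e.toMonoidHom) h' v - ((χ' h' : kˣ) : k) • v ∈ ker ρW χ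
    rw [MonoidHom.comp_apply, MulEquiv.coe_toMonoidHom, hχ]
    exact sub_mem_ker ρW χ (e h') v
  · rw [ker, Submodule.span_le]
    rintro _ ⟨⟨h, v⟩, rfl⟩
    show ρW h v - ((χ h : kˣ) : k) • v ∈ ker (ρW.comp e.toMonoidHom) χ'
    have h1 : (ρW.comp e.toMonoidHom) (e.symm h) v - ((χ' (e.symm h) : kˣ) : k) • v = ρW h v - ((χ h : kˣ) : k) • v := by
      rw [MonoidHom.comp_apply, MulEquiv.coe_toMonoidHom, hχ, MulEquiv.apply_symm_apply]
    rw [← h1]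
    exact sub_mem_ker (ρW.comp e.toMonoidHom) χ' (e.symm h) v

/-- **Coinvariant transport along a group isomorphism** `e : H′ ≃* H` with `χ′ = χ ∘ e`:
`Coinv (ρW ∘ e) χ′ ≃ₗ[k] Coinv ρW χ`, the identity on classes (`Submodule.quotEquivOfEq`); the case `χ′ = χ ∘ e`
syntactically is `TwistedCoinvariantsTensor.coinvCompEquiv`, this is the form with the character given pointwise.
[cite: GelbartRogawski1991, §3.1 Remark p. 457 L4–13] -/
def coinvTransportEquiv (hχ : ∀ h' : H', χ' h' = χ (e h')) : Coinv (ρW.comp e.toMonoidHom) χ' ≃ₗ[k] Coinv ρW χ :=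
  Submodule.quotEquivOfEq _ _ (ker_comp_eq_ker ρW χ e χ' hχ)

/-- `coinvTransportEquiv (mk v) = mk v`. [cite: GelbartRogawski1991, §3.1 Remark p. 457 L4–13] -/
@[simp] theorem coinvTransportEquiv_mk (hχ : ∀ h' : H', χ' h' = χ (e h')) (v : S) :
    coinvTransportEquiv ρW χ e χ' hχ (mk (ρW.comp e.toMonoidHom) χ' v) = mk ρW χ v := rfl

/-- `(coinvTransportEquiv).symm (mk v) = mk v`. [cite: GelbartRogawski1991, §3.1 Remark p. 457 L4–13] -/
@[simp] theorem coinvTransportEquiv_symm_mk (hχ : ∀ h' : H', χ' h' = χ (e h')) (v : S) :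
    (coinvTransportEquiv ρW χ e χ' hχ).symm (mk ρW χ v) = mk (ρW.comp e.toMonoidHom) χ' v := rfl

variable (ρV : Representation k G S)

omit [Group H'] in
/-- a representation commuting with `ρW` commutes with `ρW ∘ f` for any homomorphism `f`. [cite: MoeglinVignerasWaldspurger1987, Chap. 2 II.2] -/
theorem commute_comp_of_commute {H'' : Type*} [Group H''] (f : H'' →* H)
    (hc : ∀ (g : G) (h : H), Commute (ρV g) (ρW h)) (g : G) (h'' : H'') :
    Commute (ρV g) ((ρW.comp f) h'') :=
  hc g (f h'')

/-- **Equivariance of the transport**: for `ρV` commuting with `ρW`, `coinvTransportEquiv` intertwines the induced actions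
`rep χ′ ρV` on `Coinv (ρW ∘ e) χ′` and `rep χ ρV` on `Coinv ρW χ`. [cite: GelbartRogawski1991, §3.1 Remark p. 457 L4–13] -/
theorem coinvTransportEquiv_rep (hχ : ∀ h' : H', χ' h' = χ (e h')) (hc : ∀ (g : G) (h : H), Commute (ρV g) (ρW h))
    (g : G) (x : Coinv (ρW.comp e.toMonoidHom) χ') :
    coinvTransportEquiv ρW χ e χ' hχ (rep χ' ρV (commute_comp_of_commute ρW ρV e.toMonoidHom hc) g x) =
      rep χ ρV hc g (coinvTransportEquiv ρW χ e χ' hχ x) := by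
  obtain ⟨v, rfl⟩ := mk_surjective (ρW.comp e.toMonoidHom) χ' x
  rw [rep_mk, coinvTransportEquiv_mk, coinvTransportEquiv_mk, rep_mk]

/-- the same for the inverse. [cite: GelbartRogawski1991, §3.1 Remark p. 457 L4–13] -/
theorem coinvTransportEquiv_symm_rep (hχ : ∀ h' : H', χ' h' = χ (e h')) (hc : ∀ (g : G) (h : H), Commute (ρV g) (ρW h))
    (g : G) (y : Coinv ρW χ) :
    (coinvTransportEquiv ρW χ e χ' hχ).symm (rep χ ρV hc g y) =
      rep χ' ρV (commute_comp_of_commute ρW ρV e.toMonoidHom hc) g ((coinvTransportEquiv ρW χ e χ' hχ).symm y) := by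
  obtain ⟨v, rfl⟩ := mk_surjective ρW χ y
  rw [rep_mk, coinvTransportEquiv_symm_mk, coinvTransportEquiv_symm_mk, rep_mk]

end CompEquiv

end Literature.RepresentationTheory.TwistedCoinv

end
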